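import Summits.BirchSwinnertonDyer.BirchSwinnertonDyer.Theorems.ManinLocalTwoThreeStevensIntegralityCES
import Literature.NumberTheory.Automorphic.ShimuraCurveRibetTakahashiOptimalProofs
import Literature.NumberTheory.EllipticCurves.ManinConstantArbitraryParametrizationIntegralProofs
import Literature.NumberTheory.EllipticCurves.ManinConstantQuadraticTwistClassCertificate
import Literature.NumberTheory.EllipticCurves.ModularParametrizationDegreeHoldsProofs
import Literature.NumberTheory.EllipticCurves.ModularParametrizationTrustBaseProofs
import HarnessLib

/-!
# Stevens 1989, Prop. (1.4): the `X₁(N)`-optimal curve of an isogeny class exists — from modularity alone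

The tree's named fact `stevens1989_exists_optimal_gamma1ParametrizationData`
(`Literature/NumberTheory/EllipticCurves/ManinConstantQuadraticTwistClassCertificate.lean`: every globally minimal elliptic
`W/ℚ` of conductor `N` has a `ℚ`-isogenous globally minimal `W₁` with an OPTIMAL `X₁(N)`-datum `D₁`, `IsNewformOf W D₁.f`)
is DERIVED here from modularity (`exists_isNewformOf`, BCDT 2001 Thm. A) and nothing else, exactly as the file's
`TODO(general form)` asks ("a derivation from modularity through a `Γ₁(N)` Eichler–Shimura construction, as the tree does for
`exists_optimal_modularParametrizationData`"):

* modularity + the rational Manin constant (`IsNewformOf.exists_maninConstant_ne_zero_holds`) give an `X₀(N)`-datum of `W`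
  (`nonempty_modularParametrizationData_of_exists_isNewformOf`);
* Ribet–Takahashi / Edixhoven optimality (`exists_optimal_modularParametrizationData_of`, whose Stevens-strength integrality input
  `hInt` is the THEOREM `int_of_smul_periodLattice_le_all` of `ManinConstantArbitraryParametrizationIntegralProofs`) and its
  lattice form (`exists_optimal_modularParametrizationData_iff_latticeEq`) give a lattice-optimal `X₀(N)`-datum `D₀` on a minimal
  `W₀ ∼ W` with `IsNewformOf W D₀.f`;
* the Conrad–Edixhoven–Stein / Stevens step (`exists_optimal_gamma1ParametrizationData_holds`, re-run here as
  `exists_optimal_gamma1ParametrizationData_f_eq` to record that the `X₁(N)`-datum carries THE SAME newform `D₁.f = D₀.f`) gives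
  the optimal `X₁(N)`-datum on a minimal `W₁ ∼ W₀`.

Main results: `exists_optimal_gamma1ParametrizationData_f_eq`,
`stevens1989_exists_optimal_gamma1ParametrizationData_of_nonempty` (⟸ `nonempty_modularParametrizationData`),
`stevens1989_exists_optimal_gamma1ParametrizationData_of_exists_isNewformOf` (⟸ modularity alone).
BSD is not proved here; Manin's `c = 1` and Stevens' `c₁ = ±1` are NOT proved; uniqueness of `A₁` (Stevens (1.4)) is not transcribed.
-/

set_option autoImplicit false

set_option linter.dupNamespace false

noncomputable section

open PowerSeries
open UpperHalfPlane hiding I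
open scoped MatrixGroups PeriodPair ModularForm
open CongruenceSubgroup
open WeierstrassCurve Literature.NumberTheory.EllipticCurves Literature.NumberTheory.EllipticCurves.ModularForms
open Summit.BirchSwinnertonDyer.BirchSwinnertonDyer.Theorems.ManinLocalTwoThree.StevensCurve
open Literature.NumberTheory.Automorphic (exists_optimal_modularParametrizationData_iff_latticeEq
  exists_optimal_modularParametrizationData_of)

namespace Summit.BirchSwinnertonDyer.BirchSwinnertonDyer.Theorems.ManinLocalTwoThree.StevensIntegrality

/-- **CES §6.1 / Stevens §2, with the newform recorded.** For every globally minimal elliptic `W₀/ℚ` with a lattice-optimal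
`X₀(N)`-datum `D₀` there are a globally minimal elliptic `W₁ ∼ W₀` and an OPTIMAL `X₁(N)`-datum `D₁` of `W₁` WITH THE SAME
NEWFORM, `D₁.f = D₀.f` (the proof of `exists_optimal_gamma1ParametrizationData_holds`, whose datum is built on `D₀.f`).
[cite: ConradEdixhovenStein2003, §6.1, Lemma 6.1.6] [cite: Stevens1989, §2 (Prop. (1.4), (2.8))] -/
theorem exists_optimal_gamma1ParametrizationData_f_eq {N : ℕ} [NeZero N] (W₀ : WeierstrassCurve ℚ) [W₀.IsElliptic]
    [W₀.IsGloballyMinimal] (D₀ : ModularParametrizationData W₀ N)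
    (hopt : ∀ z ∈ D₀.L.lattice, ∃ w ∈ periodLattice D₀.f, z = D₀.c * w) :
    ∃ (W₁ : WeierstrassCurve ℚ) (_ : W₁.IsElliptic) (_ : W₁.IsGloballyMinimal)
      (D₁ : Gamma1ParametrizationData W₁ N), D₁.f = D₀.f ∧ IsIsogenous W₁ W₀ ∧ D₁.IsOptimal := by
  classical
  have hf0 : D₀.f ≠ 0 := D₀.isNewformOf.1.ne_zero
  -- the Stevens datum on the short model `E₁`, with a rational `Γ₁(N)`-presentation
  obtain ⟨E₁, hE₁, D₁, hf₁, hc₁, -, hL₁, hiso₁, k, F, G, hk, hG, hFG, hFr, hGr⟩ :=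
    exists_stevensDatum_rat_presentation D₀ hopt
  haveI := hE₁
  -- its global minimal model `W₁ = C • E₁` and a Néron pair `L'` with `Λ(L') = u·Λ₁(f)`
  obtain ⟨C, hCmin⟩ := hasGlobalMinimalModel_rat_holds E₁
  haveI := hCmin
  haveI hW₁e : ((C • E₁).baseChange ℂ).IsElliptic := by
    rw [WeierstrassCurve.baseChange]; infer_instance
  obtain ⟨L', hL'⟩ := exists_isNeronLatticeOf_holds ((C • E₁).baseChange ℂ)
  have hu0 : (C.u : ℚ) ≠ 0 := C.u.ne_zero
  have huC : ((C.u : ℚ) : ℂ) ≠ 0 := by exact_mod_cast hu0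
  have hΛ' := IsNeronLatticeOf.lattice_eq_mulLeft_of_smul C D₁.isNeronLattice hL'
  have hf' : IsNewformOf (C • E₁) D₀.f := by
    rw [← hf₁]
    exact D₁.isNewformOf.of_isIsogenous (isIsogenous_of_smul E₁ C)
  have hq : ∀ z ∈ periodLatticeGamma1 D₀.f, ((C.u : ℚ) : ℂ) * z ∈ L'.lattice := fun z hz ↦ by
    rw [hΛ', PeriodPair.mul_mem_mulLeft_lattice, hL₁]
    exact hz
  have hq' : ∀ z ∈ L'.lattice, ∃ w ∈ periodLatticeGamma1 D₀.f, z = ((C.u : ℚ) : ℂ) * w := fun z hz ↦ by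
    rw [hΛ', PeriodPair.mem_mulLeft_lattice, hL₁] at hz
    exact ⟨(((C.u : ℚ) : ℂ))⁻¹ * z, hz, by rw [← mul_assoc, mul_inv_cancel₀ huC, one_mul]⟩
  -- `u ∈ ℤ`
  obtain ⟨m, hm⟩ := int_of_neronLattice_eq_smul_periodLatticeGamma1 hf' hL' hq hq' hL₁ hk F G hG hFG hFr hGr
  have hmC : (m : ℂ) = ((C.u : ℚ) : ℂ) := by rw [← hm, Rat.cast_intCast]
  have hm0 : (m : ℂ) ≠ 0 := by rw [hmC]; exact huC
  have hmle : ∀ z ∈ periodLatticeGamma1 D₀.f, (m : ℂ) * z ∈ L'.lattice := fun z hz ↦ by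
    rw [hmC]; exact hq z hz
  -- the `X₁(N)`-datum `(f, L', c₁ := m)` on `W₁ = C • E₁`
  obtain ⟨u, hker, hsurj, hspec⟩ := IsNeronLatticeOf.exists_uniformize_holds hL'
  obtain ⟨d, hd, hfin⟩ := FlatGamma1Datum.exists_gamma1_modularDegree hf0 (L := L') hm0 hmle
  have hker' : L'.lattice.toAddSubgroup = u.ker :=
    SetLike.coe_injective (by rw [Submodule.coe_toAddSubgroup, hker])
  let e : ℂ ⧸ L'.lattice.toAddSubgroup ≃+ ((C • E₁).baseChange ℂ).toAffine.Point :=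
    QuotientAddGroup.liftEquiv L'.lattice.toAddSubgroup hsurj hker'
  have he : ∀ x : ℂ, e.toEquiv (x : ℂ ⧸ L'.lattice.toAddSubgroup) = u x := fun _ ↦ rfl
  have key := (FlatGamma1Datum.finite_setOf_natCard_gamma1FiberOrbits_ne_iff e.toEquiv
    (fun τ : ℍ ↦ (((m : ℂ) * eichlerIntegral D₀.f τ : ℂ) : ℂ ⧸ L'.lattice.toAddSubgroup)) d).mpr hfin
  simp only [he] at key
  refine ⟨C • E₁, inferInstance, hCmin,
    { f := D₀.f
      isNewformOf := hf'
      L := L'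
      isNeronLattice := hL'
      uniformize := u
      ker_uniformize := hker
      uniformize_surjective := hsurj
      uniformize_spec := hspec
      c := m
      smul_periodLatticeGamma1_le := hmle
      deg := d
      deg_pos := hd
      deg_spec := key }, rfl, ?_, ?_⟩
  · -- `W₁ ∼ W₀`
    exact (isIsogenous_of_smul E₁ C).trans' hiso₁
  · -- optimality: `Λ(L') = m·Λ₁(f)`
    intro z hz
    obtain ⟨w, hw, rfl⟩ := hq' z hz
    exact ⟨w, hw, by rw [hmC]⟩

/-- **Stevens 1989 Prop. (1.4) ⟸ `nonempty_modularParametrizationData`.** If every globally minimal elliptic curve over `ℚ`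
carries an `X₀(N)`-datum at its conductor, then every globally minimal elliptic `W/ℚ` of conductor `N` has a `ℚ`-isogenous
globally minimal `W₁` with an OPTIMAL `X₁(N)`-datum `D₁` and `IsNewformOf W D₁.f`: Ribet–Takahashi/Edixhoven `X₀(N)`-optimality in
lattice form (`exists_optimal_modularParametrizationData_of` with `hInt := int_of_smul_periodLattice_le_all`,
`exists_optimal_modularParametrizationData_iff_latticeEq`) followed by `exists_optimal_gamma1ParametrizationData_f_eq`.
[cite: Stevens1989, Prop. (1.4) p. 79 and (2.8) p. 88] [cite: ConradEdixhovenStein2003, §6.1, Lemma 6.1.6]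
[cite: EdixhovenManin1991, Prop. 2] -/
theorem stevens1989_exists_optimal_gamma1ParametrizationData_of_nonempty (hmod : nonempty_modularParametrizationData) :
    stevens1989_exists_optimal_gamma1ParametrizationData := by
  intro N _ W _ _ hN
  classical
  -- an `X₀(N)`-datum of `W`
  have hD : Nonempty (ModularParametrizationData W N) := by
    subst hN
    exact hmod W
  -- a lattice-optimal `X₀(N)`-datum `D₀` on a minimal `W₀ ∼ W`, `IsNewformOf W D₀.f`
  obtain ⟨W₀, hW₀, hW₀', D₀, hfW, hiso₀, hopt₀⟩ :=
    (exists_optimal_modularParametrizationData_iff_latticeEq.mp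
      (exists_optimal_modularParametrizationData_of int_of_smul_periodLattice_le_all)) N W hN hD
  haveI := hW₀
  haveI := hW₀'
  -- the optimal `X₁(N)`-datum on a minimal `W₁ ∼ W₀`, same newform
  obtain ⟨W₁, hW₁, hW₁', D₁, hf₁, hiso₁, hopt₁⟩ := exists_optimal_gamma1ParametrizationData_f_eq W₀ D₀ hopt₀
  refine ⟨W₁, hW₁, hW₁', D₁, ?_, ?_, hopt₁⟩
  · rw [hf₁]; exact hfW
  · haveI := hW₁
    exact hiso₀.trans' hiso₁.symm_of_charZero

/-- **Stevens 1989 Prop. (1.4) ⟸ modularity alone** (the tree's named fact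
`stevens1989_exists_optimal_gamma1ParametrizationData` derived from `exists_isNewformOf`, BCDT 2001 Thm. A): modularity and the
rational Manin constant (`IsNewformOf.exists_maninConstant_ne_zero_holds`, BCDT p. 845 (2) ⇒ (6)) give
`nonempty_modularParametrizationData` (`nonempty_modularParametrizationData_of_exists_isNewformOf`); then
`stevens1989_exists_optimal_gamma1ParametrizationData_of_nonempty`.
[cite: Stevens1989, Prop. (1.4) p. 79 and (2.8) p. 88] [cite: BCDTJAMS2001, Thm. A and p. 845 (2) ⇒ (6)]
[cite: ConradEdixhovenStein2003, §6.1, Lemma 6.1.6] -/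
theorem stevens1989_exists_optimal_gamma1ParametrizationData_of_exists_isNewformOf (hnf : exists_isNewformOf) :
    stevens1989_exists_optimal_gamma1ParametrizationData :=
  stevens1989_exists_optimal_gamma1ParametrizationData_of_nonempty
    (nonempty_modularParametrizationData_of_exists_isNewformOf hnf IsNewformOf.exists_maninConstant_ne_zero_holds)

end Summit.BirchSwinnertonDyer.BirchSwinnertonDyer.Theorems.ManinLocalTwoThree.StevensIntegrality

end
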